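import Mathlib.Analysis.Complex.Exponential
import Mathlib.Algebra.Order.Field.GeomSum
import Mathlib.Algebra.Order.Archimedean.Basic
import Mathlib.Algebra.BigOperators.Ring.Finset
import HarnessLib

/-!
# Gawędzki–Kupiainen sub-slicing, pointwise form: a geometric sum of scale-`L₀^l` massive slices has massless size

**Citation header (reproduction of the SHAPE of a published device; β sub-cell literature seat LIT2 of the Balaban
lattice Yang–Mills cell `pub-balaban`, `HOME/BETA/TRANSFER.md` §17, sibling of `LLargeDominance.lean` §(v1.2)).**
K. Gawędzki, A. Kupiainen, *Massless lattice φ⁴₄ theory: rigorous control of a renormalizable asymptotically free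
model*, Commun. Math. Phys. **99** (1985) 197–252 [GawedzkiKupiainenMasslessLattice1985]: p. 207 (2)
«𝒬_{n𝓍𝓎} = Σ_{k=0}^{n−1} L^{2(n−k)}𝒯_{kL^{n−k}𝓍L^{n−k}𝓎} = L^{2n}G_{0L^n𝓍L^n𝓎} − 𝒢_{n𝓍𝓎}» (the accumulated fluctuation
covariance as the geometric sum of rescaled one-step slices), p. 208 l. 1–2 «Computing λ_n to the second order in λ₀ is
equivalent to computing λ₁ to O(λ₀²) for L → L^n», and App. 1 (A1.6)–(A1.9) p. 248 (a blocking factor `L = L₀^m` handled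
as `m` sub-slices of fixed size `L₀`, each with fixed-`L₀` constants, summed geometrically — kernel form of the sums in
`LLargeDominance.abs_sum_le_of_subslices` / `geom_subslice_sum_le`).  The same device is the finite-range philosophy of
Bauerschmidt–Brydges–Slade, *A renormalisation group method. III*, J. Stat. Phys. **159** (2015) Prop. 6.1(a)
[BauerschmidtBrydgesSlade2015RGIII]: «|∇_x^α∇_y^β C_{j;x,y}| ≤ c(1+m²L^{2(j−1)})^{−k} L^{−(j−1)(2[φ]+(|α|₁+|β|₁))}, where
c = c(p,k,m̄²) is independent of m², j, L» — each slice massive at its own scale, with scale-free size, so that the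
SUM over slices has the massless size.

**What is proved (model-free real analysis, [folklore]; no named fact, no `sorry`).**  For a ratio `L₀ > 1`, a rate
`δ > 0`, a size exponent `s ≥ 1` (natural; `s = d − 2 + a` for a leg with `a` differences in `d = 4`: `s = 2, 3, 4`) and
ANY number `m` of slices:
* `subslice_sum_le_geom` — the trivial bound `Σ_{l<m} (L₀^l)^{−s} e^{−δ r/L₀^l} ≤ (1 − L₀^{−s})⁻¹` (size saturates at `O(1)`);
* `subslice_sum_le` — the MASSLESS SIZE: for every `r > 0`,
  `Σ_{l<m} (L₀^l)^{−s} e^{−δ r/L₀^l} ≤ K · r^{−s}`, `K = sliceConst L₀ δ s := (1 − L₀^{−s})⁻¹ + ((s+1)!/δ^{s+1})·(1 − L₀⁻¹)⁻¹`,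
  UNIFORMLY IN `m` (and in `r`): the slices with `L₀^l > r` form a geometric tail of ratio `L₀^{−s}` starting below
  `r^{−s}`; the slices with `L₀^l ≤ r` are killed by their mass, `e^{−δu} ≤ (s+1)!/(δu)^{s+1}` (`u = r/L₀^l ≥ 1`), and form a
  geometric tail of ratio `L₀⁻¹` — the bracket `L₀^n ≤ r < L₀^{n+1}` (`exists_mem_Ico_zpow`) separates the two;
* `subslice_sum_le_min` — both together: `≤ K · min 1 r^{−s}`.
* (v1.1, §2) `subslice_sum_le_min_exp` — «keeping half of each rate aside» (BETA-lead reading «G-sb12-4 under sub-slicing»,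
  journal 2026-08-18T23:52:59Z, step (S3)): since every slice rate is at least the coarsest one, `δ/L₀^l ≥ δ/L₀^m` for `l < m`,
  `Σ_{l<m} (L₀^l)^{−s} e^{−δ r/L₀^l} ≤ sliceConst L₀ (δ/2) s · min 1 r^{−s} · e^{−(δ/2) r/L₀^m}` — massless size AND the overall scale-`L₀^m`
  exponential, uniformly in `m`; consumer form `sum_le_of_slice_bounds_exp`.
* (v1.2, §3) `tailShape_of_slice_bounds` — the SAME consumer form written in the exact algebraic shape of the β sub-cell's
  exterior-leg hypothesis (`Beta/WindowInterface` `hFtail`: `R′/(r+1)^a · exp(−(δ′/n)(r+1))` on the shell `‖w‖∞ = r+1`) with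
  `n := L₀^m`, `δ′ := δ/2`, `R′ := c₀ · sliceConst L₀ (δ/2) a` — so that, on admissible blocking factors `n = L₀^m`, (S3) feeds
  (W3a)₀ by one `exact`, without the factorial/half-rate cost of a second passage through `shellBound_of_scaleExp`
  (BETA-SPEC v1.9n §7.17 (R10-1) «(S3) … assembled … with L := n»).  No import of the Beta/ modules is needed: the
  statement is shape-compatible, not name-dependent.  (v1.3) `powShape_of_slice_bounds` — the companion pure-power shape
  `S′/(r+1)^a` (the `hGtail` form, no exponential).

**Why it is in the tree / honest framing.**  This is the pointwise form of the sub-slicing device by which the two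
printed L-UNIFORM programmes obtain massless-size bounds from fixed-scale massive pieces (TRANSFER.md §17: in print NO
block-spin ONE-STEP fluctuation covariance is bounded pointwise with L-free massless size; G–K sub-slice along
`L = L₀^m`, BBS decompose into finite-range slices).  It is offered to the β sub-cell as the adapter that turns «each
transported fixed-`L₀` slice has size·rate `c₀ (L₀^l)^{−s} e^{−δ₀‖w‖/L₀^l}`» into the `‖w‖^{−s}`-size the (AF-0-L) road's
leg binders ask for (BETA-SPEC §7.14, GAPS G-sb12-4), IF that road is run on the admissible set `{L₀^m}`
(`Beta.LargeL.LogGrowthLowerOn`).  NOTHING about Bałaban's propagators (or G–K's, or BBS's) is asserted here: the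
hypotheses of any application — the slice bounds themselves — are exactly what is not in print uniformly in `L`.
Not summit progress.
-/

noncomputable section

open Finset Real

namespace Literature.MathematicalPhysics.QuantumFieldTheory.GawedzkiKupiainen1985

namespace Subslice

/-- The constant of the massless-size bound: `K(L₀, δ, s) = (1 − L₀^{−s})⁻¹ + ((s+1)!/δ^{s+1})·(1 − L₀⁻¹)⁻¹` —
depends on the sub-slice ratio `L₀`, the rate `δ` and the size exponent `s` only (NOT on the number of slices).
[folklore] -/
def sliceConst (L₀ δ : ℝ) (s : ℕ) : ℝ :=
  (1 - (L₀ ^ s)⁻¹)⁻¹ + ((s + 1).factorial / δ ^ (s + 1)) * (1 - L₀⁻¹)⁻¹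

/-- the `l`-th slice at distance `r`: size `(L₀^l)^{−s}` times the scale-`L₀^l` mass factor `e^{−δ r/L₀^l}`. [folklore] -/
def slice (L₀ δ : ℝ) (s : ℕ) (r : ℝ) (l : ℕ) : ℝ :=
  ((L₀ ^ l) ^ s)⁻¹ * Real.exp (-(δ * (r / L₀ ^ l)))

/-- `0 ≤ slice`. [folklore] -/
theorem slice_nonneg {L₀ : ℝ} (hL : 0 < L₀) (δ : ℝ) (s : ℕ) (r : ℝ) (l : ℕ) : 0 ≤ slice L₀ δ s r l := by
  unfold slice
  have : 0 < (L₀ ^ l) ^ s := by positivity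
  exact mul_nonneg (inv_nonneg.mpr this.le) (Real.exp_pos _).le

/-- the size factor is the geometric sequence `(L₀^{−s})^l`. [folklore] -/
theorem size_eq_geom (L₀ : ℝ) (s l : ℕ) : ((L₀ ^ l) ^ s)⁻¹ = ((L₀ ^ s)⁻¹) ^ l := by
  rw [inv_pow, ← pow_mul, ← pow_mul, mul_comm]

/-- each slice is at most its size: `slice ≤ (L₀^{−s})^l` (for `δ ≥ 0`, `r ≥ 0`). [folklore] -/
theorem slice_le_geom {L₀ δ r : ℝ} (hL : 0 < L₀) (hδ : 0 ≤ δ) (hr : 0 ≤ r) (s l : ℕ) :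
    slice L₀ δ s r l ≤ ((L₀ ^ s)⁻¹) ^ l := by
  unfold slice
  rw [← size_eq_geom]
  have h0 : 0 < (L₀ ^ l) ^ s := by positivity
  have hexp : Real.exp (-(δ * (r / L₀ ^ l))) ≤ 1 := by
    rw [Real.exp_le_one_iff]
    have : 0 ≤ δ * (r / L₀ ^ l) := by positivity
    linarith
  calc ((L₀ ^ l) ^ s)⁻¹ * Real.exp (-(δ * (r / L₀ ^ l))) ≤ ((L₀ ^ l) ^ s)⁻¹ * 1 :=
        mul_le_mul_of_nonneg_left hexp (inv_nonneg.mpr h0.le)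
    _ = ((L₀ ^ l) ^ s)⁻¹ := mul_one _

/-- the geometric ratio `L₀^{−s} ∈ [0,1)` for `L₀ > 1`, `s ≥ 1`. [folklore] -/
theorem ratio_lt_one {L₀ : ℝ} (hL : 1 < L₀) {s : ℕ} (hs : 1 ≤ s) : 0 ≤ (L₀ ^ s)⁻¹ ∧ (L₀ ^ s)⁻¹ < 1 := by
  have h1 : 1 < L₀ ^ s := one_lt_pow₀ hL (by omega)
  exact ⟨inv_nonneg.mpr (zero_le_one.trans h1.le), inv_lt_one_of_one_lt₀ h1⟩

/-- **the trivial (saturated) bound**: `Σ_{l<m} slice ≤ (1 − L₀^{−s})⁻¹`, uniformly in `m` and `r ≥ 0`. [folklore] -/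
theorem subslice_sum_le_geom {L₀ δ r : ℝ} (hL : 1 < L₀) (hδ : 0 ≤ δ) (hr : 0 ≤ r) {s : ℕ} (hs : 1 ≤ s) (m : ℕ) :
    ∑ l ∈ Finset.range m, slice L₀ δ s r l ≤ (1 - (L₀ ^ s)⁻¹)⁻¹ := by
  have hL0 : 0 < L₀ := lt_trans one_pos hL
  obtain ⟨hρ0, hρ1⟩ := ratio_lt_one hL hs
  calc ∑ l ∈ Finset.range m, slice L₀ δ s r l ≤ ∑ l ∈ Finset.range m, ((L₀ ^ s)⁻¹) ^ l :=
        Finset.sum_le_sum fun l _ => slice_le_geom hL0 hδ hr s l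
    _ = ∑ l ∈ Finset.Ico 0 m, ((L₀ ^ s)⁻¹) ^ l := by rw [Finset.range_eq_Ico]
    _ ≤ ((L₀ ^ s)⁻¹) ^ 0 / (1 - (L₀ ^ s)⁻¹) := geom_sum_Ico_le_of_lt_one hρ0 hρ1
    _ = (1 - (L₀ ^ s)⁻¹)⁻¹ := by rw [pow_zero, one_div]

/-- the mass kills a slice below its scale: `e^{−δu} ≤ (s+1)!/(δu)^{s+1}` for `u > 0` (Mathlib
`Real.pow_div_factorial_le_exp`). [folklore] -/
theorem exp_neg_le_factorial_div {δ u : ℝ} (hδ : 0 < δ) (hu : 0 < u) (s : ℕ) :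
    Real.exp (-(δ * u)) ≤ (s + 1).factorial / (δ * u) ^ (s + 1) := by
  have hx : 0 ≤ δ * u := by positivity
  have h := Real.pow_div_factorial_le_exp (δ * u) hx (s + 1)
  have hfac : (0 : ℝ) < (s + 1).factorial := by exact_mod_cast Nat.factorial_pos _
  have hpow : 0 < (δ * u) ^ (s + 1) := by positivity
  rw [Real.exp_neg, inv_le_comm₀ (Real.exp_pos _) (by positivity), inv_div]
  calc (δ * u) ^ (s + 1) / (s + 1).factorial ≤ Real.exp (δ * u) := h

/-- **a slice BELOW the distance** (`L₀^l ≤ r`, so `u = r/L₀^l ≥ 1`): killed by its mass down to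
`((s+1)!/δ^{s+1}) · r^{−s} · (L₀^l / r)`. [folklore] -/
theorem slice_le_of_scale_le {L₀ δ r : ℝ} (hL : 0 < L₀) (hδ : 0 < δ) (hr : 0 < r) (s l : ℕ) :
    slice L₀ δ s r l ≤ ((s + 1).factorial / δ ^ (s + 1)) * (r ^ s)⁻¹ * (L₀ ^ l / r) := by
  unfold slice
  set P : ℝ := L₀ ^ l with hP
  have hP0 : 0 < P := by positivity
  have hu : 0 < r / P := div_pos hr hP0
  have h1 := exp_neg_le_factorial_div hδ hu s
  have hPs : 0 < (P ^ s)⁻¹ := by positivity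
  have hPne : P ≠ 0 := hP0.ne'
  have hrne : r ≠ 0 := hr.ne'
  have hδne : δ ≠ 0 := hδ.ne'
  calc (P ^ s)⁻¹ * Real.exp (-(δ * (r / P)))
      ≤ (P ^ s)⁻¹ * ((s + 1).factorial / (δ * (r / P)) ^ (s + 1)) := mul_le_mul_of_nonneg_left h1 hPs.le
    _ = ((s + 1).factorial / δ ^ (s + 1)) * (r ^ s)⁻¹ * (P / r) := by
        have key : (P ^ s)⁻¹ * P ^ (s + 1) = P := by
          rw [pow_succ, ← mul_assoc, inv_mul_cancel₀ (pow_ne_zero s hPne), one_mul]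
        have key2 : (r ^ (s + 1))⁻¹ = (r ^ s)⁻¹ * r⁻¹ := by
          rw [pow_succ, mul_inv]
        calc (P ^ s)⁻¹ * (↑(s + 1).factorial / (δ * (r / P)) ^ (s + 1))
            = (P ^ s)⁻¹ * P ^ (s + 1) * ((↑(s + 1).factorial / δ ^ (s + 1)) * (r ^ (s + 1))⁻¹) := by
              rw [mul_pow, div_pow]
              field_simp
          _ = ((s + 1).factorial / δ ^ (s + 1)) * (r ^ s)⁻¹ * (P / r) := by
              rw [key, key2, div_eq_mul_inv P r]
              ring

/-- **a slice ABOVE the distance** (`r < L₀^l`): at most its size `(L₀^{−s})^l`, and the sizes of all such slices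
form a geometric tail starting below `r^{−s}`; here the pointwise half. [folklore] -/
theorem slice_le_size {L₀ δ r : ℝ} (hL : 0 < L₀) (hδ : 0 ≤ δ) (hr : 0 ≤ r) (s l : ℕ) :
    slice L₀ δ s r l ≤ ((L₀ ^ s)⁻¹) ^ l := slice_le_geom hL hδ hr s l

/-- **G–K / BBS sub-slicing, pointwise form: a geometric sum of scale-`L₀^l` massive slices has MASSLESS SIZE,
uniformly in the number of slices.**  For `L₀ > 1`, `δ > 0`, `s ≥ 1`, every `r > 0` and every `m`,
`Σ_{l<m} (L₀^l)^{−s} e^{−δ r/L₀^l} ≤ sliceConst L₀ δ s · r^{−s}`. [folklore] -/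
theorem subslice_sum_le {L₀ δ r : ℝ} (hL : 1 < L₀) (hδ : 0 < δ) (hr : 0 < r) {s : ℕ} (hs : 1 ≤ s) (m : ℕ) :
    ∑ l ∈ Finset.range m, slice L₀ δ s r l ≤ sliceConst L₀ δ s * (r ^ s)⁻¹ := by
  classical
  have hL0 : 0 < L₀ := lt_trans one_pos hL
  have hL1 : 1 ≤ L₀ := hL.le
  obtain ⟨hρ0, hρ1⟩ := ratio_lt_one hL hs
  set ρ : ℝ := (L₀ ^ s)⁻¹ with hρ
  set C : ℝ := (s + 1).factorial / δ ^ (s + 1) with hC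
  have hC0 : 0 ≤ C := by positivity
  have hrs : 0 < r ^ s := pow_pos hr s
  -- the bracket `L₀^n ≤ r < L₀^(n+1)`
  obtain ⟨n, hn_le, hn_lt⟩ := exists_mem_Ico_zpow hr hL
  -- split the slices at the distance
  set A := (Finset.range m).filter (fun l => r < L₀ ^ l) with hA
  set B := (Finset.range m).filter (fun l => ¬ r < L₀ ^ l) with hB
  have hsplit : ∑ l ∈ Finset.range m, slice L₀ δ s r l
      = ∑ l ∈ A, slice L₀ δ s r l + ∑ l ∈ B, slice L₀ δ s r l :=
    (Finset.sum_filter_add_sum_filter_not _ _ _).symm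
  -- Part A: slices above the distance — geometric tail of ratio `ρ` starting at `l₁ = (n+1)⁺`, below `r^{−s}`
  set l₁ : ℕ := (n + 1).toNat with hl₁
  have hA_sub : A ⊆ Finset.Ico l₁ m := by
    intro l hl
    rw [hA, Finset.mem_filter, Finset.mem_range] at hl
    obtain ⟨hlm, hrl⟩ := hl
    rw [Finset.mem_Ico]
    refine ⟨?_, hlm⟩
    -- `L₀^n ≤ r < L₀^l` ⇒ `n < l` ⇒ `(n+1)⁺ ≤ l`
    have h1 : L₀ ^ n < L₀ ^ (l : ℤ) := by
      rw [zpow_natCast]; exact lt_of_le_of_lt hn_le hrl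
    have h2 : n < (l : ℤ) := (zpow_lt_zpow_iff_right₀ hL).mp h1
    omega
  have hr_le : r ≤ L₀ ^ l₁ := by
    have h1 : n + 1 ≤ (l₁ : ℤ) := Int.self_le_toNat _
    have h2 : L₀ ^ (n + 1) ≤ L₀ ^ (l₁ : ℤ) := zpow_le_zpow_right₀ hL1 h1
    rw [zpow_natCast] at h2
    exact hn_lt.le.trans h2
  have hA_sum : ∑ l ∈ A, slice L₀ δ s r l ≤ (1 - ρ)⁻¹ * (r ^ s)⁻¹ := by
    calc ∑ l ∈ A, slice L₀ δ s r l ≤ ∑ l ∈ A, ρ ^ l :=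
          Finset.sum_le_sum fun l _ => slice_le_size hL0 hδ.le hr.le s l
      _ ≤ ∑ l ∈ Finset.Ico l₁ m, ρ ^ l :=
          Finset.sum_le_sum_of_subset_of_nonneg hA_sub fun l _ _ => pow_nonneg hρ0 l
      _ ≤ ρ ^ l₁ / (1 - ρ) := geom_sum_Ico_le_of_lt_one hρ0 hρ1
      _ ≤ (r ^ s)⁻¹ / (1 - ρ) := by
          apply div_le_div_of_nonneg_right _ (by linarith)
          rw [hρ, ← size_eq_geom]
          exact inv_anti₀ hrs (pow_le_pow_left₀ hr.le hr_le s)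
      _ = (1 - ρ)⁻¹ * (r ^ s)⁻¹ := by rw [div_eq_mul_inv, mul_comm]
  -- Part B: slices below the distance — killed by the mass, geometric tail of ratio `L₀⁻¹` ending at `n⁺`
  set N : ℕ := n.toNat with hN
  have hB_pt : ∀ l ∈ B, slice L₀ δ s r l ≤ C * (r ^ s)⁻¹ * (L₀⁻¹) ^ (N - l) := by
    intro l hl
    rw [hB, Finset.mem_filter, Finset.mem_range] at hl
    obtain ⟨_, hrl⟩ := hl
    push Not at hrl
    -- `L₀^l ≤ r < L₀^(n+1)` ⇒ `l ≤ n`, `n = N`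
    have h1 : L₀ ^ (l : ℤ) < L₀ ^ (n + 1) := by
      rw [zpow_natCast]; exact lt_of_le_of_lt hrl hn_lt
    have h2 : (l : ℤ) < n + 1 := (zpow_lt_zpow_iff_right₀ hL).mp h1
    have hlN : l ≤ N := by omega
    have hNn : (N : ℤ) = n := by omega
    have hLn : L₀ ^ n = L₀ ^ N := by rw [← hNn, zpow_natCast]
    have step := slice_le_of_scale_le hL0 hδ hr s l
    -- `L₀^l / r ≤ L₀^l / L₀^N = (L₀⁻¹)^(N−l)`
    have hquot : L₀ ^ l / r ≤ (L₀⁻¹) ^ (N - l) := by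
      have hLN : 0 < L₀ ^ N := by positivity
      have h3 : L₀ ^ l / r ≤ L₀ ^ l / L₀ ^ N := by
        apply div_le_div_of_nonneg_left (by positivity) hLN
        rw [← hLn]; exact hn_le
      have h4 : L₀ ^ l / L₀ ^ N = (L₀⁻¹) ^ (N - l) := by
        have hL0' : L₀ ≠ 0 := hL0.ne'
        have hsp : L₀ ^ N = L₀ ^ l * L₀ ^ (N - l) := by
          rw [← pow_add, Nat.add_sub_of_le hlN]
        rw [inv_pow, hsp]
        field_simp
      exact h3.trans_eq h4
    have hpre : 0 ≤ C * (r ^ s)⁻¹ := by positivity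
    calc slice L₀ δ s r l ≤ C * (r ^ s)⁻¹ * (L₀ ^ l / r) := step
      _ ≤ C * (r ^ s)⁻¹ * (L₀⁻¹) ^ (N - l) := mul_le_mul_of_nonneg_left hquot hpre
  have hx0 : 0 ≤ L₀⁻¹ := inv_nonneg.mpr hL0.le
  have hx1 : L₀⁻¹ < 1 := inv_lt_one_of_one_lt₀ hL
  have hB_geom : ∑ l ∈ B, (L₀⁻¹) ^ (N - l) ≤ (1 - L₀⁻¹)⁻¹ := by
    -- reindex `i = N − l` (injective on `B ⊆ {l ≤ N}`), land in `range (N+1)`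
    have hinj : ∀ l ∈ B, ∀ l' ∈ B, N - l = N - l' → l = l' := by
      intro l hl l' hl' h
      rw [hB, Finset.mem_filter, Finset.mem_range] at hl hl'
      have h1 : L₀ ^ (l : ℤ) < L₀ ^ (n + 1) := by
        rw [zpow_natCast]; exact lt_of_le_of_lt (not_lt.mp hl.2) hn_lt
      have h1' : L₀ ^ (l' : ℤ) < L₀ ^ (n + 1) := by
        rw [zpow_natCast]; exact lt_of_le_of_lt (not_lt.mp hl'.2) hn_lt
      have h2 : (l : ℤ) < n + 1 := (zpow_lt_zpow_iff_right₀ hL).mp h1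
      have h2' : (l' : ℤ) < n + 1 := (zpow_lt_zpow_iff_right₀ hL).mp h1'
      omega
    rw [← Finset.sum_image hinj]
    have hsub : B.image (fun l => N - l) ⊆ Finset.Ico 0 (N + 1) := by
      intro i hi
      rw [Finset.mem_image] at hi
      obtain ⟨l, _, rfl⟩ := hi
      rw [Finset.mem_Ico]
      omega
    calc ∑ i ∈ B.image (fun l => N - l), (L₀⁻¹) ^ i ≤ ∑ i ∈ Finset.Ico 0 (N + 1), (L₀⁻¹) ^ i :=
          Finset.sum_le_sum_of_subset_of_nonneg hsub fun i _ _ => pow_nonneg hx0 i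
      _ ≤ (L₀⁻¹) ^ 0 / (1 - L₀⁻¹) := geom_sum_Ico_le_of_lt_one hx0 hx1
      _ = (1 - L₀⁻¹)⁻¹ := by rw [pow_zero, one_div]
  have hB_sum : ∑ l ∈ B, slice L₀ δ s r l ≤ C * (1 - L₀⁻¹)⁻¹ * (r ^ s)⁻¹ := by
    calc ∑ l ∈ B, slice L₀ δ s r l ≤ ∑ l ∈ B, C * (r ^ s)⁻¹ * (L₀⁻¹) ^ (N - l) := Finset.sum_le_sum hB_pt
      _ = C * (r ^ s)⁻¹ * ∑ l ∈ B, (L₀⁻¹) ^ (N - l) := by rw [Finset.mul_sum]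
      _ ≤ C * (r ^ s)⁻¹ * (1 - L₀⁻¹)⁻¹ := mul_le_mul_of_nonneg_left hB_geom (by positivity)
      _ = C * (1 - L₀⁻¹)⁻¹ * (r ^ s)⁻¹ := by ring
  -- assemble
  rw [hsplit]
  calc ∑ l ∈ A, slice L₀ δ s r l + ∑ l ∈ B, slice L₀ δ s r l
      ≤ (1 - ρ)⁻¹ * (r ^ s)⁻¹ + C * (1 - L₀⁻¹)⁻¹ * (r ^ s)⁻¹ := add_le_add hA_sum hB_sum
    _ = sliceConst L₀ δ s * (r ^ s)⁻¹ := by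
        unfold sliceConst; rw [← hρ, ← hC]; ring

/-- `sliceConst ≥ (1 − L₀^{−s})⁻¹ ≥ 1 > 0`. [folklore] -/
theorem geomConst_le_sliceConst {L₀ δ : ℝ} (hL : 1 < L₀) (hδ : 0 < δ) {s : ℕ} (hs : 1 ≤ s) :
    (1 - (L₀ ^ s)⁻¹)⁻¹ ≤ sliceConst L₀ δ s := by
  unfold sliceConst
  have hx1 : L₀⁻¹ < 1 := inv_lt_one_of_one_lt₀ hL
  have : 0 ≤ ((s + 1).factorial / δ ^ (s + 1)) * (1 - L₀⁻¹)⁻¹ := by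
    have : 0 < 1 - L₀⁻¹ := by linarith
    positivity
  have _ := hs
  linarith

/-- **both regimes at once**: `Σ_{l<m} (L₀^l)^{−s} e^{−δ r/L₀^l} ≤ sliceConst · min 1 r^{−s}` for every `r > 0` and
every `m` — the massless size `‖·‖^{−s} ∧ O(1)` of a multiscale sum, with a constant free of the number of slices.
[folklore] -/
theorem subslice_sum_le_min {L₀ δ r : ℝ} (hL : 1 < L₀) (hδ : 0 < δ) (hr : 0 < r) {s : ℕ} (hs : 1 ≤ s) (m : ℕ) :
    ∑ l ∈ Finset.range m, slice L₀ δ s r l ≤ sliceConst L₀ δ s * min 1 (r ^ s)⁻¹ := by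
  rcases le_total 1 (r ^ s)⁻¹ with h | h
  · rw [min_eq_left h, mul_one]
    exact (subslice_sum_le_geom hL hδ.le hr.le hs m).trans (geomConst_le_sliceConst hL hδ hs)
  · rw [min_eq_right h]
    exact subslice_sum_le hL hδ hr hs m

/-- The form consumers meet: slices given as a family `T l` dominated by `c₀ · (L₀^l)^{−s} e^{−δ r/L₀^l}` (e.g. transported
fixed-`L₀` one-step pieces with size·rate bounds at their own scale) sum to at most `c₀ · sliceConst · min 1 r^{−s}`,
whatever the number `m` of slices. [folklore] -/
theorem sum_le_of_slice_bounds {L₀ δ r c₀ : ℝ} (hL : 1 < L₀) (hδ : 0 < δ) (hr : 0 < r) (hc₀ : 0 ≤ c₀) {s : ℕ}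
    (hs : 1 ≤ s) (m : ℕ) (T : ℕ → ℝ) (hT : ∀ l, l < m → |T l| ≤ c₀ * slice L₀ δ s r l) :
    |∑ l ∈ Finset.range m, T l| ≤ c₀ * sliceConst L₀ δ s * min 1 (r ^ s)⁻¹ := by
  calc |∑ l ∈ Finset.range m, T l| ≤ ∑ l ∈ Finset.range m, |T l| := Finset.abs_sum_le_sum_abs _ _
    _ ≤ ∑ l ∈ Finset.range m, c₀ * slice L₀ δ s r l :=
        Finset.sum_le_sum fun l hl => hT l (Finset.mem_range.mp hl)
    _ = c₀ * ∑ l ∈ Finset.range m, slice L₀ δ s r l := by rw [Finset.mul_sum]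
    _ ≤ c₀ * (sliceConst L₀ δ s * min 1 (r ^ s)⁻¹) :=
        mul_le_mul_of_nonneg_left (subslice_sum_le_min hL hδ hr hs m) hc₀
    _ = c₀ * sliceConst L₀ δ s * min 1 (r ^ s)⁻¹ := by ring

/-! ## §2 (v1.1) Keeping half of each rate aside: massless size times the coarsest-scale exponential -/

/-- splitting the mass factor: `slice L₀ δ s r l ≤ slice L₀ (δ/2) s r l · e^{−(δ/2)·r/L₀^m}` for `l < m` (every slice rate
`δ/L₀^l` is at least the coarsest `δ/L₀^m`; `L₀ ≥ 1`, `δ ≥ 0`, `r ≥ 0`). [folklore] -/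
theorem slice_le_slice_half_mul_exp {L₀ δ r : ℝ} (hL : 1 ≤ L₀) (hδ : 0 ≤ δ) (hr : 0 ≤ r) (s : ℕ) {l m : ℕ}
    (hlm : l < m) :
    slice L₀ δ s r l ≤ slice L₀ (δ / 2) s r l * Real.exp (-(δ / 2 * (r / L₀ ^ m))) := by
  unfold slice
  have hL0 : 0 < L₀ := lt_of_lt_of_le one_pos hL
  have hPl : 0 < L₀ ^ l := pow_pos hL0 l
  have hPm : 0 < L₀ ^ m := pow_pos hL0 m
  have hpow : L₀ ^ l ≤ L₀ ^ m := pow_le_pow_right₀ hL hlm.le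
  -- `r/L₀^m ≤ r/L₀^l`
  have hu : r / L₀ ^ m ≤ r / L₀ ^ l := div_le_div_of_nonneg_left hr hPl hpow
  have hsplit : Real.exp (-(δ * (r / L₀ ^ l)))
      = Real.exp (-(δ / 2 * (r / L₀ ^ l))) * Real.exp (-(δ / 2 * (r / L₀ ^ l))) := by
    rw [← Real.exp_add]; congr 1; ring
  have hmono : Real.exp (-(δ / 2 * (r / L₀ ^ l))) ≤ Real.exp (-(δ / 2 * (r / L₀ ^ m))) := by
    apply Real.exp_le_exp.mpr
    have hδ2 : 0 ≤ δ / 2 := by linarith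
    have := mul_le_mul_of_nonneg_left hu hδ2
    linarith
  have hinv : 0 ≤ ((L₀ ^ l) ^ s)⁻¹ := inv_nonneg.mpr (pow_nonneg hPl.le s)
  have he : 0 ≤ Real.exp (-(δ / 2 * (r / L₀ ^ l))) := (Real.exp_pos _).le
  rw [hsplit, ← mul_assoc]
  exact mul_le_mul_of_nonneg_left hmono (mul_nonneg hinv he)

/-- **massless size AND the coarsest-scale exponential, uniformly in the number of slices** («keeping half of each
rate aside»): for `L₀ > 1`, `δ > 0`, `s ≥ 1`, `r > 0` and every `m`,
`Σ_{l<m} (L₀^l)^{−s} e^{−δ r/L₀^l} ≤ sliceConst L₀ (δ/2) s · min 1 r^{−s} · e^{−(δ/2) r/L₀^m}`. [folklore] -/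
theorem subslice_sum_le_min_exp {L₀ δ r : ℝ} (hL : 1 < L₀) (hδ : 0 < δ) (hr : 0 < r) {s : ℕ} (hs : 1 ≤ s) (m : ℕ) :
    ∑ l ∈ Finset.range m, slice L₀ δ s r l
      ≤ sliceConst L₀ (δ / 2) s * min 1 (r ^ s)⁻¹ * Real.exp (-(δ / 2 * (r / L₀ ^ m))) := by
  have hδ2 : 0 < δ / 2 := by linarith
  have hE : 0 ≤ Real.exp (-(δ / 2 * (r / L₀ ^ m))) := (Real.exp_pos _).le
  calc ∑ l ∈ Finset.range m, slice L₀ δ s r l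
      ≤ ∑ l ∈ Finset.range m, slice L₀ (δ / 2) s r l * Real.exp (-(δ / 2 * (r / L₀ ^ m))) :=
        Finset.sum_le_sum fun l hl => slice_le_slice_half_mul_exp hL.le hδ.le hr.le s (Finset.mem_range.mp hl)
    _ = (∑ l ∈ Finset.range m, slice L₀ (δ / 2) s r l) * Real.exp (-(δ / 2 * (r / L₀ ^ m))) := by
        rw [Finset.sum_mul]
    _ ≤ sliceConst L₀ (δ / 2) s * min 1 (r ^ s)⁻¹ * Real.exp (-(δ / 2 * (r / L₀ ^ m))) :=
        mul_le_mul_of_nonneg_right (subslice_sum_le_min hL hδ2 hr hs m) hE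

/-- consumer form with the coarsest-scale exponential: `|T_l| ≤ c₀·slice L₀ δ s r l` for `l < m` ⟹
`|Σ_{l<m} T_l| ≤ c₀ · sliceConst L₀ (δ/2) s · min 1 r^{−s} · e^{−(δ/2) r/L₀^m}` — the `hPow ∧ hExp` shape of a leg bound at
the top scale `L₀^m` from fixed-ratio slice bounds, constants free of `m`. [folklore] -/
theorem sum_le_of_slice_bounds_exp {L₀ δ r c₀ : ℝ} (hL : 1 < L₀) (hδ : 0 < δ) (hr : 0 < r) (hc₀ : 0 ≤ c₀) {s : ℕ}
    (hs : 1 ≤ s) (m : ℕ) (T : ℕ → ℝ) (hT : ∀ l, l < m → |T l| ≤ c₀ * slice L₀ δ s r l) :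
    |∑ l ∈ Finset.range m, T l|
      ≤ c₀ * sliceConst L₀ (δ / 2) s * min 1 (r ^ s)⁻¹ * Real.exp (-(δ / 2 * (r / L₀ ^ m))) := by
  calc |∑ l ∈ Finset.range m, T l| ≤ ∑ l ∈ Finset.range m, |T l| := Finset.abs_sum_le_sum_abs _ _
    _ ≤ ∑ l ∈ Finset.range m, c₀ * slice L₀ δ s r l :=
        Finset.sum_le_sum fun l hl => hT l (Finset.mem_range.mp hl)
    _ = c₀ * ∑ l ∈ Finset.range m, slice L₀ δ s r l := by rw [Finset.mul_sum]
    _ ≤ c₀ * (sliceConst L₀ (δ / 2) s * min 1 (r ^ s)⁻¹ * Real.exp (-(δ / 2 * (r / L₀ ^ m)))) :=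
        mul_le_mul_of_nonneg_left (subslice_sum_le_min_exp hL hδ hr hs m) hc₀
    _ = c₀ * sliceConst L₀ (δ / 2) s * min 1 (r ^ s)⁻¹ * Real.exp (-(δ / 2 * (r / L₀ ^ m))) := by ring

/-! ## §3 (v1.2) The consumer form in the exterior-leg shape `R′/(r+1)^a · e^{−(δ′/n)(r+1)}`, `n = L₀^m` -/

/-- `sliceConst L₀ δ s > 0` for `L₀ > 1`, `δ > 0` (first summand `≥ 0`, second `> 0`). [folklore] -/
theorem sliceConst_pos {L₀ δ : ℝ} (hL : 1 < L₀) (hδ : 0 < δ) (s : ℕ) : 0 < sliceConst L₀ δ s := by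
  unfold sliceConst
  have hA : 0 ≤ (1 - (L₀ ^ s)⁻¹)⁻¹ :=
    inv_nonneg.2 (sub_nonneg.2 (inv_le_one_of_one_le₀ (one_le_pow₀ hL.le)))
  have hB : 0 < ((s + 1).factorial / δ ^ (s + 1)) * (1 - L₀⁻¹)⁻¹ :=
    mul_pos (div_pos (by exact_mod_cast Nat.factorial_pos _) (pow_pos hδ _))
      (inv_pos.2 (sub_pos.2 (inv_lt_one_of_one_lt₀ hL)))
  exact add_pos_of_nonneg_of_pos hA hB

/-- **(S3) IN THE (W3a)-LEG SHAPE.**  If the `l`-th transported slice of a leg obeys, on the shell `‖w‖∞ = r+1`, the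
fixed-ratio scale bound `|T l| ≤ c₀ · (L₀^l)^{−a} · e^{−δ (r+1)/L₀^l}` for every `l < m`, then the summed leg obeys
`|Σ_{l<m} T l| ≤ R′/(r+1)^a · exp(−((δ/2)/L₀^m)·(r+1))` with `R′ = c₀ · sliceConst L₀ (δ/2) a` — FREE of `m` and `r`.  This is
literally the shape of the β sub-cell's exterior-leg hypothesis at blocking factor `n = L₀^m` with rate `δ/2`
(`sum_le_of_slice_bounds_exp` at `r+1 > 0`, and `min 1 x⁻¹ ≤ x⁻¹`). [folklore] -/
theorem tailShape_of_slice_bounds {L₀ δ c₀ : ℝ} (hL : 1 < L₀) (hδ : 0 < δ) (hc₀ : 0 ≤ c₀) {a : ℕ} (ha : 1 ≤ a)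
    (m r : ℕ) (T : ℕ → ℝ) (hT : ∀ l, l < m → |T l| ≤ c₀ * slice L₀ δ a ((r : ℝ) + 1) l) :
    |∑ l ∈ Finset.range m, T l|
      ≤ c₀ * sliceConst L₀ (δ / 2) a / ((r : ℝ) + 1) ^ a * Real.exp (-(δ / 2 / L₀ ^ m) * ((r : ℝ) + 1)) := by
  have hr : (0 : ℝ) < (r : ℝ) + 1 := by positivity
  have h := sum_le_of_slice_bounds_exp hL hδ hr hc₀ ha m T hT
  have hK : 0 ≤ c₀ * sliceConst L₀ (δ / 2) a :=
    mul_nonneg hc₀ (sliceConst_pos hL (half_pos hδ) a).le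
  have hmin : min 1 ((((r : ℝ) + 1) ^ a)⁻¹) ≤ (((r : ℝ) + 1) ^ a)⁻¹ := min_le_right _ _
  have hexp : Real.exp (-(δ / 2 * (((r : ℝ) + 1) / L₀ ^ m))) = Real.exp (-(δ / 2 / L₀ ^ m) * ((r : ℝ) + 1)) := by
    congr 1; ring
  calc |∑ l ∈ Finset.range m, T l|
      ≤ c₀ * sliceConst L₀ (δ / 2) a * min 1 ((((r : ℝ) + 1) ^ a)⁻¹) * Real.exp (-(δ / 2 * (((r : ℝ) + 1) / L₀ ^ m))) := h
    _ ≤ c₀ * sliceConst L₀ (δ / 2) a * (((r : ℝ) + 1) ^ a)⁻¹ * Real.exp (-(δ / 2 * (((r : ℝ) + 1) / L₀ ^ m))) := by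
        gcongr
    _ = c₀ * sliceConst L₀ (δ / 2) a / ((r : ℝ) + 1) ^ a * Real.exp (-(δ / 2 / L₀ ^ m) * ((r : ℝ) + 1)) := by
        rw [hexp, div_eq_mul_inv (c₀ * sliceConst L₀ (δ / 2) a)]

/-- The same with the blocking factor written as `n` (`n = L₀^m` supplied as a hypothesis), i.e. verbatim the exterior-leg
shape `R′/(r+1)^a · exp(−(δ′/n)(r+1))`. [folklore] -/
theorem tailShape_of_slice_bounds' {L₀ δ c₀ n : ℝ} (hL : 1 < L₀) (hδ : 0 < δ) (hc₀ : 0 ≤ c₀) {a : ℕ} (ha : 1 ≤ a)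
    (m r : ℕ) (hn : n = L₀ ^ m) (T : ℕ → ℝ) (hT : ∀ l, l < m → |T l| ≤ c₀ * slice L₀ δ a ((r : ℝ) + 1) l) :
    |∑ l ∈ Finset.range m, T l|
      ≤ c₀ * sliceConst L₀ (δ / 2) a / ((r : ℝ) + 1) ^ a * Real.exp (-(δ / 2 / n) * ((r : ℝ) + 1)) := by
  subst hn
  exact tailShape_of_slice_bounds hL hδ hc₀ ha m r T hT

/-- **(S3) IN THE PURE-POWER LEG SHAPE** (the companion hypothesis without exponential, `S′/(r+1)^a`): under the same
per-slice bounds, `|Σ_{l<m} T l| ≤ c₀ · sliceConst L₀ δ a / (r+1)^a` — the massless size alone (`sum_le_of_slice_bounds` at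
`r+1 ≥ 1`, where `min 1 (r+1)^{−a} = (r+1)^{−a}`), constant free of `m` and `r`. [folklore] -/
theorem powShape_of_slice_bounds {L₀ δ c₀ : ℝ} (hL : 1 < L₀) (hδ : 0 < δ) (hc₀ : 0 ≤ c₀) {a : ℕ} (ha : 1 ≤ a)
    (m r : ℕ) (T : ℕ → ℝ) (hT : ∀ l, l < m → |T l| ≤ c₀ * slice L₀ δ a ((r : ℝ) + 1) l) :
    |∑ l ∈ Finset.range m, T l| ≤ c₀ * sliceConst L₀ δ a / ((r : ℝ) + 1) ^ a := by
  have hr : (0 : ℝ) < (r : ℝ) + 1 := by positivity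
  have h := sum_le_of_slice_bounds hL hδ hr hc₀ ha m T hT
  have hK : 0 ≤ c₀ * sliceConst L₀ δ a := mul_nonneg hc₀ (sliceConst_pos hL hδ a).le
  have hmin : min 1 ((((r : ℝ) + 1) ^ a)⁻¹) ≤ (((r : ℝ) + 1) ^ a)⁻¹ := min_le_right _ _
  calc |∑ l ∈ Finset.range m, T l| ≤ c₀ * sliceConst L₀ δ a * min 1 ((((r : ℝ) + 1) ^ a)⁻¹) := h
    _ ≤ c₀ * sliceConst L₀ δ a * (((r : ℝ) + 1) ^ a)⁻¹ := by gcongr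
    _ = c₀ * sliceConst L₀ δ a / ((r : ℝ) + 1) ^ a := by rw [div_eq_mul_inv (c₀ * sliceConst L₀ δ a)]

end Subslice

end Literature.MathematicalPhysics.QuantumFieldTheory.GawedzkiKupiainen1985
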